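import Summits.QuantumFields.YangMills.Theorems.AlphaInputsT3ACv3LinearLiftMatrixLift
import HarnessLib

/-!
# `AlphaInputsT3ACv3LinearLiftMatrixTwist` — (V) THE MATRIX-VALUED PORT OF THE (LL) ENGINE, PART 4: the TWISTED kernel port `Σ_c T(δ_c)(b) • ψ_{b,c}(A c)` (per-pair
# `ℝ`-linear maps on the coefficients — the transported frames `Ad(P_U(b₋ ← y))` of the COVARIANT spread of w1's Newton architecture v2), its `𝔰𝔲(N)`-valuedness, its `ℓ^∞`
# bound with the SAME constant for contractive frames, and ★ the FRAME-COMPARISON COST `‖twisted − untwisted‖ ≤ C·θ·M` — cell `ym3-torus`, width seat `ym-ust-19936-w3` (g0)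

WHY (ym3-torus STATUS 2026-08-28T00:57:37Z, ★w1-19936 PROGRESS 6, NEWTON ARCHITECTURE v2 for the `hLift` binder of RULING g24-№4): the defect `ξ` of a non-abelian candidate is
`𝔰𝔲(2)`-valued in the adjoint frame at each coarse bond, and «no global small gauge exists on a large `Ω`, so the lift of `ξ` must be the COVARIANT spread `Σ_y w(b,y)·Ad(P_U(b₋←y)) ξ(y,·)`
with frames transported along the (0.3) combs inside the `3^d`-cell stencil; … the frames are `1 + O(dBε)`»; the contraction then uses «(a) (V2) exactness `Q^(k) ∘ liftM = id` (w3)»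
for the UNtwisted port plus the frame-comparison cost.  Parts 1–3 (`…LinearLiftMatrix`, `…Lift`, `…Region`) gave the untwisted port `byEntry` with its kernel form
`byEntry T A b = Σ_c T(δ_c)(b) • A c` (`byEntry_eq_sum_kernel`).  THIS FILE types the twisted version GENERICALLY (any LINEAR scalar operator `T`, any family of `ℝ`-linear
coefficient maps `ψ b c`):
* §9 `byEntryTw T ψ A b := Σ_c T(δ_c)(b) • ψ b c (A c)`; `byEntryTw_id` (trivial frames = `byEntry`); ★ `byEntryTw_mem` (`𝔰𝔲(N)`-valued whenever the `ψ b c` preserve `𝔰𝔲(N)`, e.g.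
  `Ad g`); ★ `norm_byEntryTw_le_of_bound`: an `ℓ^∞ → ℓ^∞` bound of `T` («`|T f (b)| ≤ C·M` whenever `|f c| ≤ M` on `N`») ports with the SAME constant for frames that are
  CONTRACTIVE on the sub-family `N` (isometries `Ad g`); ★★ `norm_byEntryTw_sub_byEntry_le`: if `‖ψ b c X − X‖ ≤ θ·‖X‖` on `N` then `‖byEntryTw T ψ A b − byEntry T A b‖ ≤ C·(θ·M)` —
  the frame-comparison cost is the kernel's `ℓ¹`-mass times `θ`, NO dimension-of-the-group factor.
* §10 the instances on w2's torus lift: `liftMTw k ψ A := byEntryTw (liftL P k) ψ A` with `liftMTw_mem`, ★ `norm_liftMTw_le` (`≤ (d+1)·18^d·M`, k-UNIFORM, from part 2's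
  `abs_lift_le`), ★★ `norm_liftMTw_sub_liftM_le` (`≤ (d+1)·18^d·θ·M`) and, through part 2's `norm_linAvgIterM_le` and EXACTNESS `linAvgIterM_liftM`, ★★ the EXACTNESS DEFECT of
  the twisted lift `‖linAvgIterM k (liftMTw k ψ A) c − A c‖ ≤ ((d+1)·L^k)·((d+1)·18^d·θ·M)` (`norm_linAvgIterM_liftMTw_sub_le`; the `L^k` is the honest price of a lift that is not
  sup-spread — with the sup-small lift `liftS` announced by ★w2 g2 (`|liftS| ≤ C·M∕L^k`) the same three lines give a k-UNIFORM defect; that port follows its landing).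
HONEST FRAMING.  Finite-dimensional real linear algebra; the frames `ψ` are ABSTRACT (no transport is constructed here); nothing of [Balaban1985UV3]∕[Balaban1985Variational]∕
[Balaban1985Averaging] is asserted; (FL), the stub 2′χ, the crux `HistoryTailL` and any gap are NOT claimed; count-neutral helper (`--supports stmt-QuantumFields-19936`);
registry untouched.  YM₃ on the three-torus is a RUNG of the programme, not the Clay problem; nothing here is about d = 4, infinite volume or a mass gap.

References: T. Bałaban, Commun. Math. Phys. 109 (1987) 249–301 [Balaban1987RG1] ((0.3)–(0.4) pp.252–253, (0.11) p.253); Commun. Math. Phys. 98 (1985) 17–51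
[Balaban1985Averaging] ((9), (11) pp.18–19: gauge covariance of the averaging); B. C. Hall, Lie Groups, Lie Algebras, and Representations (2015) [Hall2015] (Example 7.3).
-/

set_option autoImplicit false

noncomputable section

open scoped Matrix.Norms.L2Operator

namespace Summit.QuantumFields.YangMills.Theorems.LinearLiftMatrix

open Finset
open Literature.MathematicalPhysics.QuantumFieldTheory.Balaban1983to89
open Literature.MathematicalPhysics.QuantumFieldTheory.Balaban1985CMP102.Setting
open Summit.QuantumFields.Balaban3D.Carriers
open Summit.QuantumFields.YangMills.Theorems.LinearLiftSpread (lift)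

/-! ## §9 The twisted kernel port -/

section Twisted

variable {n : Type*} {ι κ : Type*} [Fintype ι] [DecidableEq ι]

/-- **THE TWISTED ENTRYWISE EXTENSION**: the kernel of a LINEAR scalar operator `T` acting on matrix coefficients through per-pair `ℝ`-linear maps `ψ b c` (frames):
`byEntryTw T ψ A b = Σ_c T(δ_c)(b) • ψ b c (A c)`. [cite: Balaban1985Averaging, (9)+(11) pp.18–19] -/
def byEntryTw (T : (ι → ℝ) →ₗ[ℝ] (κ → ℝ)) (ψ : κ → ι → Matrix n n ℂ →ₗ[ℝ] Matrix n n ℂ) (A : ι → Matrix n n ℂ) (b : κ) : Matrix n n ℂ :=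
  ∑ c, (T (Pi.single c 1) b) • ψ b c (A c)

/-- `byEntryTw` unfolded. [folklore] -/
theorem byEntryTw_def (T : (ι → ℝ) →ₗ[ℝ] (κ → ℝ)) (ψ : κ → ι → Matrix n n ℂ →ₗ[ℝ] Matrix n n ℂ) (A : ι → Matrix n n ℂ) (b : κ) :
    byEntryTw T ψ A b = ∑ c, (T (Pi.single c 1) b) • ψ b c (A c) := rfl

/-- **TRIVIAL FRAMES GIVE THE UNTWISTED PORT**: `byEntryTw T (fun _ _ => id) = byEntry T` (kernel form `byEntry_eq_sum_kernel`). [folklore] -/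
theorem byEntryTw_id (T : (ι → ℝ) →ₗ[ℝ] (κ → ℝ)) (A : ι → Matrix n n ℂ) (b : κ) :
    byEntryTw T (fun _ _ => LinearMap.id) A b = byEntry T A b := by
  rw [byEntryTw_def, byEntry_eq_sum_kernel]
  rfl

/-- **★ SUBMODULE PRESERVATION**: if every frame `ψ b c` maps the `ℝ`-submodule `S` into itself (e.g. `Ad g` on `𝔰𝔲(N)`) and `A` is `S`-valued, the twisted extension is `S`-valued.
[cite: Hall2015, Example 7.3] -/
theorem byEntryTw_mem (T : (ι → ℝ) →ₗ[ℝ] (κ → ℝ)) (ψ : κ → ι → Matrix n n ℂ →ₗ[ℝ] Matrix n n ℂ) (S : Submodule ℝ (Matrix n n ℂ))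
    (hψ : ∀ b c X, X ∈ S → ψ b c X ∈ S) {A : ι → Matrix n n ℂ} (hA : ∀ c, A c ∈ S) (b : κ) : byEntryTw T ψ A b ∈ S := by
  rw [byEntryTw_def]
  exact S.sum_mem fun c _ => S.smul_mem _ (hψ b c _ (hA c))

variable [Fintype n] [DecidableEq n]

/-- **★ THE PORT OF AN `ℓ^∞` BOUND THROUGH CONTRACTIVE FRAMES, SAME CONSTANT**: if `|T f (b)| ≤ C·M` whenever `|f c| ≤ M` on `N`, and the frames are contractive on `N`
(`‖ψ b c X‖ ≤ ‖X‖`, e.g. isometries `Ad g`), then `‖byEntryTw T ψ A b‖ ≤ C·M` whenever `‖A c‖ ≤ M` on `N`. [folklore] -/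
theorem norm_byEntryTw_le_of_bound (T : (ι → ℝ) →ₗ[ℝ] (κ → ℝ)) (ψ : κ → ι → Matrix n n ℂ →ₗ[ℝ] Matrix n n ℂ) (N : ι → Prop) (b : κ) {C : ℝ}
    (hT : ∀ (f : ι → ℝ) (M : ℝ), (∀ c, N c → |f c| ≤ M) → |T f b| ≤ C * M) (hψ : ∀ c, N c → ∀ X, ‖ψ b c X‖ ≤ ‖X‖)
    (A : ι → Matrix n n ℂ) {M : ℝ} (hM : 0 ≤ M) (hA : ∀ c, N c → ‖A c‖ ≤ M) :
    ‖byEntryTw T ψ A b‖ ≤ C * M := by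
  classical
  rw [byEntryTw_def]
  have hterm : ∀ c, ‖(T (Pi.single c 1) b) • ψ b c (A c)‖ ≤ |T (Pi.single c 1) b| * M := fun c => by
    rw [norm_smul, Real.norm_eq_abs]
    by_cases hc : N c
    · exact mul_le_mul_of_nonneg_left ((hψ c hc _).trans (hA c hc)) (abs_nonneg _)
    · rw [kernel_eq_zero_of_bound T N b hT hc, abs_zero, zero_mul, zero_mul]
  calc ‖∑ c, (T (Pi.single c 1) b) • ψ b c (A c)‖ ≤ ∑ c, |T (Pi.single c 1) b| * M := norm_sum_le_of_le _ fun c _ => hterm c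
    _ = (∑ c, |T (Pi.single c 1) b|) * M := by rw [sum_mul]
    _ ≤ C * M := mul_le_mul_of_nonneg_right (sum_abs_kernel_le_of_bound T N b hT) hM

/-- **★★ THE FRAME-COMPARISON COST**: if `|T f (b)| ≤ C·M` whenever `|f c| ≤ M` on `N`, and the frames are `θ`-close to the identity on `N` (`‖ψ b c X − X‖ ≤ θ·‖X‖`), then
`‖byEntryTw T ψ A b − byEntry T A b‖ ≤ C·(θ·M)` whenever `‖A c‖ ≤ M` on `N` — the twisted port differs from the untwisted one by the kernel's `ℓ¹`-mass times `θ·M`; NO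
dimension-of-the-group factor. [folklore] -/
theorem norm_byEntryTw_sub_byEntry_le (T : (ι → ℝ) →ₗ[ℝ] (κ → ℝ)) (ψ : κ → ι → Matrix n n ℂ →ₗ[ℝ] Matrix n n ℂ) (N : ι → Prop) (b : κ) {C : ℝ}
    (hT : ∀ (f : ι → ℝ) (M : ℝ), (∀ c, N c → |f c| ≤ M) → |T f b| ≤ C * M) {θ : ℝ} (hθ : 0 ≤ θ) (hψ : ∀ c, N c → ∀ X, ‖ψ b c X - X‖ ≤ θ * ‖X‖)
    (A : ι → Matrix n n ℂ) {M : ℝ} (hM : 0 ≤ M) (hA : ∀ c, N c → ‖A c‖ ≤ M) :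
    ‖byEntryTw T ψ A b - byEntry T A b‖ ≤ C * (θ * M) := by
  classical
  rw [byEntryTw_def, byEntry_eq_sum_kernel, ← sum_sub_distrib]
  have hterm : ∀ c, ‖(T (Pi.single c 1) b) • ψ b c (A c) - (T (Pi.single c 1) b) • A c‖ ≤ |T (Pi.single c 1) b| * (θ * M) := fun c => by
    rw [← smul_sub, norm_smul, Real.norm_eq_abs]
    by_cases hc : N c
    · refine mul_le_mul_of_nonneg_left ((hψ c hc _).trans ?_) (abs_nonneg _)
      exact mul_le_mul_of_nonneg_left (hA c hc) hθ
    · rw [kernel_eq_zero_of_bound T N b hT hc, abs_zero, zero_mul, zero_mul]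
  calc ‖∑ c, ((T (Pi.single c 1) b) • ψ b c (A c) - (T (Pi.single c 1) b) • A c)‖
      ≤ ∑ c, |T (Pi.single c 1) b| * (θ * M) := norm_sum_le_of_le _ fun c _ => hterm c
    _ = (∑ c, |T (Pi.single c 1) b|) * (θ * M) := by rw [sum_mul]
    _ ≤ C * (θ * M) := mul_le_mul_of_nonneg_right (sum_abs_kernel_le_of_bound T N b hT) (mul_nonneg hθ hM)

end Twisted

/-! ## §10 The twisted torus lift -/

section TwistedLift

variable {P : Params} {n : Type*}

open scoped Classical in
/-- **THE TWISTED MATRIX LIFT** on the torus: w2's `lift k` in kernel form with per-pair frames `ψ` (the covariant spread of w1's Newton architecture v2 when `ψ b c = Ad(P_U(b₋ ← c))`).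
[cite: Balaban1987RG1, (0.4)+(0.11) p.253; Balaban1985Averaging, (11) p.19] -/
def liftMTw (k : ℕ) (ψ : PBond P 0 → PBond P k → Matrix n n ℂ →ₗ[ℝ] Matrix n n ℂ) (A : PBond P k → Matrix n n ℂ) : PBond P 0 → Matrix n n ℂ :=
  byEntryTw (liftL P k) ψ A

variable (k : ℕ) (ψ : PBond P 0 → PBond P k → Matrix n n ℂ →ₗ[ℝ] Matrix n n ℂ)

open scoped Classical in
/-- `liftMTw` unfolded (with the classical decidability of bonds). [folklore] -/
theorem liftMTw_eq (A : PBond P k → Matrix n n ℂ) : liftMTw k ψ A = byEntryTw (liftL P k) ψ A := rfl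

/-- Trivial frames: `liftMTw k id = liftM k`. [cite: Balaban1987RG1, (0.4)+(0.11) p.253] -/
theorem liftMTw_id (A : PBond P k → Matrix n n ℂ) (b : PBond P 0) : liftMTw k (fun _ _ => LinearMap.id) A b = liftM k A b := by
  classical
  rw [liftMTw_eq, liftM_eq, byEntry_congr (T := lift k) (fun f => (liftL_apply k f).symm)]
  convert byEntryTw_id (liftL P k) A b

/-- **★ THE TWISTED LIFT IS `𝔰𝔲(N)`-VALUED** whenever the frames preserve `𝔰𝔲(N)` (e.g. `Ad g`) and the data are `𝔰𝔲(N)`-valued (any `ℝ`-submodule). [cite: Hall2015, Example 7.3] -/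
theorem liftMTw_mem (S : Submodule ℝ (Matrix n n ℂ)) (hψ : ∀ b c X, X ∈ S → ψ b c X ∈ S) {A : PBond P k → Matrix n n ℂ} (hA : ∀ c, A c ∈ S) (b : PBond P 0) :
    liftMTw k ψ A b ∈ S := by
  classical
  rw [liftMTw_eq]
  convert byEntryTw_mem (liftL P k) ψ S hψ hA b

variable [Fintype n] [DecidableEq n]

/-- **★ THE k-UNIFORM SUP BOUND OF THE TWISTED LIFT** for contractive frames: `‖A c‖ ≤ M` ⇒ `‖liftMTw k ψ A b‖ ≤ (d+1)·18^d·M` (part 2's `abs_lift_le` through the twisted port).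
[cite: Balaban1987RG1, (0.4)+(0.11) p.253] -/
theorem norm_liftMTw_le (hψ : ∀ b c X, ‖ψ b c X‖ ≤ ‖X‖) (A : PBond P k → Matrix n n ℂ) {M : ℝ} (hA : ∀ c, ‖A c‖ ≤ M) (b : PBond P 0) :
    ‖liftMTw k ψ A b‖ ≤ (((P.d : ℝ) + 1) * (18 : ℝ) ^ P.d) * M := by
  classical
  have hM : 0 ≤ M := (norm_nonneg _).trans (hA ⟨fun _ => 0, b.dir⟩)
  rw [liftMTw_eq]
  convert norm_byEntryTw_le_of_bound (liftL P k) ψ (fun _ => True) b (fun f M' hf => abs_lift_le k f (fun c => hf c trivial) b) (fun c _ X => hψ b c X) A hM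
    (fun c _ => hA c) using 1

/-- **★★ THE FRAME-COMPARISON COST OF THE TWISTED LIFT**: frames `θ`-close to the identity (`‖ψ b c X − X‖ ≤ θ·‖X‖`) move the lift by at most `(d+1)·18^d·θ·M` in sup norm,
uniformly in `k`. [cite: Balaban1985Averaging, (11) p.19; Balaban1987RG1, (0.4) p.253] -/
theorem norm_liftMTw_sub_liftM_le {θ : ℝ} (hθ : 0 ≤ θ) (hψ : ∀ b c X, ‖ψ b c X - X‖ ≤ θ * ‖X‖) (A : PBond P k → Matrix n n ℂ) {M : ℝ} (hA : ∀ c, ‖A c‖ ≤ M)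
    (b : PBond P 0) : ‖liftMTw k ψ A b - liftM k A b‖ ≤ (((P.d : ℝ) + 1) * (18 : ℝ) ^ P.d) * (θ * M) := by
  classical
  have hM : 0 ≤ M := (norm_nonneg _).trans (hA ⟨fun _ => 0, b.dir⟩)
  rw [liftMTw_eq, liftM_eq, byEntry_congr (T := lift k) (fun f => (liftL_apply k f).symm)]
  convert norm_byEntryTw_sub_byEntry_le (liftL P k) ψ (fun _ => True) b (fun f M' hf => abs_lift_le k f (fun c => hf c trivial) b) hθ
    (fun c _ X => hψ b c X) A hM (fun c _ => hA c) using 1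

/-- The iterated matrix average is linear: subtraction (entrywise `LinearLiftSpread.linAvgIter_sub`). [cite: Balaban1987RG1, (0.11) p.253] -/
theorem linAvgIterM_sub [Nonempty n] (s : ℕ) (Y Z : PBond P 0 → Matrix n n ℂ) (c : PBond P s) :
    linAvgIterM s (Y - Z) c = linAvgIterM s Y c - linAvgIterM s Z c := by
  rw [linAvgIterM_eq_byEntry, linAvgIterM_eq_byEntry, linAvgIterM_eq_byEntry]
  ext i l
  apply Complex.ext
  · have h : (fun b => ((Y - Z) b i l).re) = (fun b => (Y b i l).re) - fun b => (Z b i l).re := by funext b; simp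
    rw [byEntry_apply_re, h, LinearLiftSpread.linAvgIter_sub, Pi.sub_apply, Matrix.sub_apply, Complex.sub_re, byEntry_apply_re, byEntry_apply_re]
  · have h : (fun b => ((Y - Z) b i l).im) = (fun b => (Y b i l).im) - fun b => (Z b i l).im := by funext b; simp
    rw [byEntry_apply_im, h, LinearLiftSpread.linAvgIter_sub, Pi.sub_apply, Matrix.sub_apply, Complex.sub_im, byEntry_apply_im, byEntry_apply_im]

/-- **★★ THE EXACTNESS DEFECT OF THE TWISTED LIFT**: `‖(Q₁^k (liftMTw k ψ A))(c) − A c‖ ≤ ((d+1)·L^k)·((d+1)·18^d·θ·M)` — EXACTNESS of the untwisted lift (`linAvgIterM_liftM`),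
linearity of `Q₁^k` and its k-uniform sup bound (`norm_linAvgIterM_le`) applied to the frame-comparison cost.  (The factor `L^k` is the honest price of a lift that is not
sup-spread; for a sup-small lift with `‖·‖ ≤ C·M∕L^k` the same three lines give a k-uniform defect.) [cite: Balaban1987RG1, (0.4)+(0.11) p.253; Balaban1985Averaging, (11) p.19] -/
theorem norm_linAvgIterM_liftMTw_sub_le [Nonempty n] (hk : k ≤ P.m + P.K) {θ : ℝ} (hθ : 0 ≤ θ) (hψ : ∀ b c X, ‖ψ b c X - X‖ ≤ θ * ‖X‖)
    (A : PBond P k → Matrix n n ℂ) {M : ℝ} (hA : ∀ c, ‖A c‖ ≤ M) (c : PBond P k) :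
    ‖linAvgIterM k (liftMTw k ψ A) c - A c‖ ≤ (((P.d : ℝ) + 1) * (P.L : ℝ) ^ k) * ((((P.d : ℝ) + 1) * (18 : ℝ) ^ P.d) * (θ * M)) := by
  have hlin : linAvgIterM k (liftMTw k ψ A) c - A c = linAvgIterM k (liftMTw k ψ A - liftM k A) c := by
    rw [linAvgIterM_sub, linAvgIterM_liftM k hk A]
  rw [hlin]
  exact norm_linAvgIterM_le k _ (fun b => norm_liftMTw_sub_liftM_le k ψ hθ hψ A hA b) c

end TwistedLift

end Summit.QuantumFields.YangMills.Theorems.LinearLiftMatrix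

end
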